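import Mathlib.RingTheory.Polynomial.Pochhammer
import Mathlib.Tactic
import HarnessLib

/-!
# Rising-factorial pairs are coefficientwise monotone towards the extremes (engine of Θ⁺⁺ ⟸ TAIL⁺)

Support file for the Sahi / Conjecture-P programme of route `PercNearOneGluingNoHeavy`
(`--supports stmt-CriticalPhenomena-4575`, prover prim-l12-p5 gen 30; proof note
`prim-l12-p5/MULTITYPE-PROOF-g30.md` §5.5(d), 'REDUCTION Θ⁺⁺(single) ⟸ TAIL⁺').  No definitions, no named facts,
no sorries.

CONJECTURE Θ⁺⁺ (single type) says that the LSM minor of the de Finetti law, a combination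
`∑_m Ẽ_m θ^{(m)} θ^{(h-m)}` of products of rising factorials `θ^{(m)} = θ(θ+1)⋯(θ+m-1)`, has non-negative
coefficients as a polynomial in `θ`.  The reduction to the `θ`-free tail condition TAIL⁺ of OMEGA1-g27 §4
rests on one identity: `θ^{(m)}θ^{(n+1)} − θ^{(m+1)}θ^{(n)} = (n − m)·θ^{(m)}θ^{(n)}`, so that for `m ≤ n` the
product `θ^{(m)}θ^{(n+1)}` (the more 'spread' pair) dominates `θ^{(m+1)}θ^{(n)}` COEFFICIENTWISE.  Here, with
Mathlib's `ascPochhammer ℕ k = X(X+1)⋯(X+k-1)`: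

* `asc_pair_identity` : `asc m * asc (n+1) = asc (m+1) * asc n + (n - m) * (asc m * asc n)` over `ℕ` (`m ≤ n`);
* `asc_pair_coeff_mono` : `coeff g (asc (m+1) * asc n) ≤ coeff g (asc m * asc (n+1))` for `m ≤ n`, every `g`.
-/

namespace Summit.CriticalPhenomena.PercolationContinuityZ3.Theorems

namespace AscPochPair

open Polynomial

/-- **The pair identity** for rising factorials (over `ℕ`, `m ≤ n`):
`θ^{(m)}·θ^{(n+1)} = θ^{(m+1)}·θ^{(n)} + (n−m)·θ^{(m)}θ^{(n)}`, from `θ^{(k+1)} = θ^{(k)}·(θ+k)`. -/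
theorem asc_pair_identity (m n : ℕ) (hmn : m ≤ n) :
    ascPochhammer ℕ m * ascPochhammer ℕ (n + 1) =
      ascPochhammer ℕ (m + 1) * ascPochhammer ℕ n +
        ((n - m : ℕ) : ℕ[X]) * (ascPochhammer ℕ m * ascPochhammer ℕ n) := by
  rw [ascPochhammer_succ_right ℕ n, ascPochhammer_succ_right ℕ m]
  obtain ⟨d, rfl⟩ := Nat.exists_eq_add_of_le hmn
  simp only [Nat.add_sub_cancel_left, Nat.cast_add]
  ring

/-- **Coefficientwise monotonicity of rising-factorial pairs**: for `m ≤ n` and every degree `g`,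
`[θ^g] θ^{(m+1)}θ^{(n)} ≤ [θ^g] θ^{(m)}θ^{(n+1)}` — moving one unit from the smaller to the larger index
can only increase every coefficient (all polynomials involved have coefficients in `ℕ`). -/
theorem asc_pair_coeff_mono (m n : ℕ) (hmn : m ≤ n) (g : ℕ) :
    (ascPochhammer ℕ (m + 1) * ascPochhammer ℕ n).coeff g ≤
      (ascPochhammer ℕ m * ascPochhammer ℕ (n + 1)).coeff g := by
  rw [asc_pair_identity m n hmn, coeff_add]
  exact Nat.le_add_right _ _

end AscPochPair

end Summit.CriticalPhenomena.PercolationContinuityZ3.Theorems
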